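import Summits.AtomisticToContinuum.HydrodynamicLimit.Theorems.LambertianContactSwapLambertianEulerShellCountMoments
import Summits.AtomisticToContinuum.HydrodynamicLimit.Theorems.LambertianContactSwapLambertianEulerStarShells
import Summits.AtomisticToContinuum.HydrodynamicLimit.Theorems.LambertianContactSwapLambertianEulerDisjointShells
import HarnessLib

/-!
# The `N`-uniform upper tail of the shell-pair count at equilibrium
# (`LambertianContactSwap.LambertianEuler`, stmt-AtomisticToContinuum-11854, line `Sketch`; lead c10,
# wave 2, piece W8 `ShellCountTail`, part 2 of 2: registered stub `shellCount_overflow_le`)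

Support file (`--supports stmt-AtomisticToContinuum-11854`).  For a configuration `y` of `N + 1` hard
spheres of diameter `ε = hsDiameter σ N` on `𝕋³` and a width `0 ≤ δ ≤ ε ≤ 1/4` let `F_δ(y)` be the
number of ORDERED velocity-shell pairs `(i, j)`, `i ≠ j`, `ε ≤ d(x_i, x_j) ≤ ε + δ ‖v_i − v_j‖` (the
STATIC SHELL COUNT, the cell term of lead c10's concentration theorem for the Lambertian window
collision count), `μ := (N+1)² ε² δ`, and `G` the rung-0 local Gibbs law (constant profiles
`b, ϑ > 0`, `w`; `0 < σ < 1/2`, `v₁ σ³ ≤ 1/2`).  Only UPPER (insertion) bounds on Gibbs probabilities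
are available, so the threshold sits a constant factor above the mean and the tail comes from
moments of all orders:

* MOMENTS (`lintegral_shellCount_pow_le`): `E_G[F_δ^k] ≤ 2 (A μ)^k + B_k (N + 1)` with `A = A(w, ϑ)`
  independent of `k` — part 1's `lintegral_card_filter_pow_le` with the matching probability
  `≤ 4^k (C₄ ε² δ)^k` (`…ShellCountMoments.localGibbsLaw_matchingShells_le` and
  `…DisjointShells.pi_disjointShells_le`) and the star probability `≤ 2^{k+1} C₃ ε^{2k} δ^k`
  (`localGibbsLaw_starShells_le`: the insertion bound `…GibbsInsertionZip.localGibbsLaw_le_pow_mul_pi`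
  on the `k + 1` particles of the star, and `…StarShells.pi_starShells_le` with exponent `0`); the
  star term is `N`-uniform because `k! C(N, k) ε^{2k} δ^k ≤ N^k ε^{3k} ≤ ((N+1) ε³)^k = σ^{3k} ≤ 1`
  (`succ_mul_hsDiameter_pow_three`); `A := 4 C₄`, `B_k := (4k²)^k k^k (1 + 2^{k+1} C₃) + 1`.
* TAIL (`shellCount_overflow_le`, the registered stub): `C₀ := 2A`; given `η` pick `k = j + 2` with
  `8A/η < 2^j`; pointwise `(x − r)₊ ≤ x^k / r^{k−1}` (`sub_le_pow_div_pow`), so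
  `E_G[(F_δ − C₀μ)₊] ≤ (2 (Aμ)^k + B_k (N+1)) / (2Aμ)^{k−1} ≤ η μ` as soon as `2Aμ ≥ 1`,
  `s₀ (N+1) ≤ μ` and `μ ≥ B_k / (s₀ η A)`.

References: the matching/star decomposition of moments of pair counts, Janson–Łuczak–Ruciński,
*Random Graphs*, §6.1; Cercignani–Illner–Pulvirenti 1994 §2.2; Pulvirenti–Tsagkarogiannis 2012 §3.
All statements [folklore] given the landed inputs.
-/

noncomputable section

namespace Summit.AtomisticToContinuum.HydrodynamicLimit.Theorems.LambertianContactSwapLambertianEulerShellCountTail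

open scoped BigOperators Topology ENNReal InnerProductSpace
open MeasureTheory ProbabilityTheory Filter Set
open Literature.MathematicalPhysics.KineticTheory Literature.MathematicalPhysics.StatisticalMechanics
open Literature.Analysis.FluidPDE
open Summit.AtomisticToContinuum.HydrodynamicLimit.Theorems.LambertianContactSwapLambertianEulerGibbsInsertionZip
open Summit.AtomisticToContinuum.HydrodynamicLimit.Theorems.LambertianContactSwapLambertianEulerStarShells
open Summit.AtomisticToContinuum.HydrodynamicLimit.Theorems.LambertianContactSwapLambertianEulerDisjointShells
open Summit.AtomisticToContinuum.HydrodynamicLimit.Theorems.LambertianContactSwapLambertianEulerShellCountMoments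

/-! ## A star of shells under the Gibbs law -/

/-- **Gibbs probability of a star of shells.**  For a centre `a` and a `k`-set `B ∌ a` of leaves, the
event that all `(a, j)`, `j ∈ B`, are non-degenerate velocity shells depends only on the `k + 1`
particles `{a} ∪ B`, so by the insertion bound `localGibbsLaw_le_pow_mul_pi` a free-law bound
`U {star} ≤ Q` (leaves enumerated by `Finset.orderEmbOfFin`) gives the Gibbs bound `2^{k+1} Q`.
[folklore] -/
theorem localGibbsLaw_starShells_le (b ϑ : ℝ) (w : V3) (hb : 0 < b) (hϑ : 0 < ϑ) (σ : ℝ)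
    (hσ : 0 < σ) (hσ2 : σ < 1 / 2) (hlam : v₁ * σ ^ 3 ≤ 1 / 2) (N : ℕ)
    (Φ : HardSphereFlow (Torus.geometry (Fin 3)) (hsDiameter σ N) (N + 1)) (δ : ℝ) {Q : ℝ≥0∞} (k : ℕ)
    (hU : ∀ (a : Fin (N + 1)) (bs : Fin k → Fin (N + 1)), Function.Injective bs → (∀ i, bs i ≠ a) →
      Measure.pi (fun _ : Fin (N + 1) => (volume : Measure T3).prod (gaussMeasure w ϑ))
        {y : Config (N + 1) (Fin 3) T3 | ∀ i,
          hsDiameter σ N ≤ ‖(Torus.geometry (Fin 3)).sepVec (y a).1 (y (bs i)).1‖ ∧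
          ‖(Torus.geometry (Fin 3)).sepVec (y a).1 (y (bs i)).1‖ ≤
            hsDiameter σ N + δ * ‖(y a).2 - (y (bs i)).2‖} ≤ Q)
    (a : Fin (N + 1)) (B : Finset (Fin (N + 1))) (hB : B ∈ (Finset.univ.erase a).powersetCard k) :
    localGibbsLaw σ (fun _ => b) (fun _ => w) (fun _ => ϑ) N Φ
      {y | ∀ j ∈ B, a ≠ j ∧
          (hsDiameter σ N ≤ ‖(Torus.geometry (Fin 3)).sepVec (y a).1 (y j).1‖ ∧
          ‖(Torus.geometry (Fin 3)).sepVec (y a).1 (y j).1‖ ≤ hsDiameter σ N + δ * ‖(y a).2 - (y j).2‖)} ≤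
      2 ^ (k + 1) * Q := by
  set S : Set (Config (N + 1) (Fin 3) T3) := {y | ∀ j ∈ B, a ≠ j ∧
      (hsDiameter σ N ≤ ‖(Torus.geometry (Fin 3)).sepVec (y a).1 (y j).1‖ ∧
      ‖(Torus.geometry (Fin 3)).sepVec (y a).1 (y j).1‖ ≤ hsDiameter σ N + δ * ‖(y a).2 - (y j).2‖)}
    with hSdef
  obtain ⟨hBsub, hBcard⟩ := Finset.mem_powersetCard.1 hB
  have haB : a ∉ B := fun h => (Finset.mem_erase.1 (hBsub h)).1 rfl
  have hS : MeasurableSet S := by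
    have hBeq : S = ⋂ j ∈ B, {y : Config (N + 1) (Fin 3) T3 | a ≠ j ∧
        (hsDiameter σ N ≤ ‖(Torus.geometry (Fin 3)).sepVec (y a).1 (y j).1‖ ∧
        ‖(Torus.geometry (Fin 3)).sepVec (y a).1 (y j).1‖ ≤ hsDiameter σ N + δ * ‖(y a).2 - (y j).2‖)} := by
      ext y
      simp only [hSdef, Set.mem_setOf_eq, Set.mem_iInter]
    rw [hBeq]
    exact B.measurableSet_biInter fun j _ =>
      (MeasurableSet.const _).inter (measurableSet_shell N (hsDiameter σ N) δ a j)
  have hdet : ∀ y y' : Config (N + 1) (Fin 3) T3, (∀ i ∈ insert a B, y i = y' i) → (y ∈ S ↔ y' ∈ S) := by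
    intro y y' h
    have ha := h a (Finset.mem_insert_self _ _)
    simp only [hSdef, Set.mem_setOf_eq]
    refine forall₂_congr fun j hj => ?_
    rw [ha, h j (Finset.mem_insert_of_mem hj)]
  have hcard : (insert a B).card = k + 1 := by rw [Finset.card_insert_of_notMem haB, hBcard]
  have hbsB : ∀ i : Fin k, B.orderEmbOfFin hBcard i ∈ B := fun i => Finset.orderEmbOfFin_mem B hBcard i
  have hba : ∀ i : Fin k, B.orderEmbOfFin hBcard i ≠ a := fun i h => haB (h ▸ hbsB i)
  calc localGibbsLaw σ (fun _ => b) (fun _ => w) (fun _ => ϑ) N Φ S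
      ≤ 2 ^ (insert a B).card *
          Measure.pi (fun _ : Fin (N + 1) => (volume : Measure T3).prod (gaussMeasure w ϑ)) S :=
        localGibbsLaw_le_pow_mul_pi b ϑ w hb hϑ σ hσ hσ2 hlam N Φ (insert a B) S hS hdet
    _ ≤ 2 ^ (k + 1) * Q := by
        rw [hcard]
        exact mul_le_mul_right ((measure_mono fun y hy i => (hy _ (hbsB i)).2).trans
          (hU a (fun i => B.orderEmbOfFin hBcard i) (B.orderEmbOfFin hBcard).injective hba)) _

/-! ## The moment bound -/

/-- **Moments of all orders of the static shell count under the rung-0 Gibbs law.**  There is `A = A(w, ϑ) > 0` and for every `k` a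
`B = B(w, ϑ, k) > 0` such that for all `0 < σ < 1/2` with `v₁ σ³ ≤ 1/2`, all `N`, every flow `Φ` and
every width `0 ≤ δ ≤ ε := hsDiameter σ N ≤ 1/4`:
`∫⁻ (F_δ)^k dG ≤ ofReal (2 (A (N+1)² ε² δ)^k + B (N + 1))`, `F_δ(y)` the number of ordered shell pairs
`(i ≠ j, ε ≤ d(x_i, x_j) ≤ ε + δ ‖v_i − v_j‖)` of `y` and `G` the local Gibbs law with constant profiles
`b, w, ϑ` (pointwise `card_filter_pow_le`; the insertion bound and the free-law matching / star
estimates `localGibbsLaw_matchingShells_le`, `localGibbsLaw_starShells_le`; `(N+1) ε³ = σ³ ≤ 1`).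
[folklore] -/
theorem lintegral_shellCount_pow_le :
    ∀ (b ϑ : ℝ) (w : V3), 0 < b → 0 < ϑ → ∃ A : ℝ, 0 < A ∧ ∀ k : ℕ, ∃ B : ℝ, 0 < B ∧
      ∀ σ : ℝ, 0 < σ → σ < 1 / 2 → v₁ * σ ^ 3 ≤ 1 / 2 →
      ∀ (N : ℕ) (Φ : HardSphereFlow (Torus.geometry (Fin 3)) (hsDiameter σ N) (N + 1)) (δ : ℝ),
        0 ≤ δ → δ ≤ hsDiameter σ N → hsDiameter σ N ≤ 1 / 4 →
        ∫⁻ y, ENNReal.ofReal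
            ((∑ q : Fin (N + 1) × Fin (N + 1),
                if q.1 ≠ q.2 ∧ hsDiameter σ N ≤ ‖(Torus.geometry (Fin 3)).sepVec (y q.1).1 (y q.2).1‖ ∧
                    ‖(Torus.geometry (Fin 3)).sepVec (y q.1).1 (y q.2).1‖ ≤ hsDiameter σ N + δ * ‖(y q.1).2 - (y q.2).2‖
                then (1 : ℝ) else 0) ^ k)
          ∂(localGibbsLaw σ (fun _ => b) (fun _ => w) (fun _ => ϑ) N Φ) ≤
        ENNReal.ofReal (2 * (A * (((N : ℝ) + 1) ^ 2 * hsDiameter σ N ^ 2 * δ)) ^ k + B * ((N : ℝ) + 1)) := by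
  intro b ϑ w hb hϑ
  obtain ⟨C₄, hC₄0, hC₄⟩ := pi_disjointShells_le w ϑ
  refine ⟨4 * C₄, by positivity, fun k => ?_⟩
  obtain ⟨C₃, hC₃0, hC₃⟩ := pi_starShells_le w ϑ k 0
  refine ⟨(4 * (k : ℝ) ^ 2) ^ k * ((k : ℝ) ^ k * (1 + 2 ^ (k + 1) * C₃)) + 1, by positivity, ?_⟩
  intro σ hσ hσ2 hlam N Φ δ hδ hδε hε4
  set ε := hsDiameter σ N with hε
  have hε0 : 0 < ε := hsDiameter_pos hσ N
  set G := localGibbsLaw σ (fun _ => b) (fun _ => w) (fun _ => ϑ) N Φ with hG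
  haveI : IsProbabilityMeasure G := isProbabilityMeasure_localGibbsLaw continuous_const
    continuous_const continuous_const (fun _ => hb) (fun _ => hϑ) (by linarith) N Φ
  -- the free-law bounds of the landed static estimates
  have hMU : ∀ t : Fin k → Fin (N + 1) × Fin (N + 1), (∀ l, (t l).1 ≠ (t l).2) →
      (∀ l l', l ≠ l' → Disjoint ({(t l).1, (t l).2} : Finset (Fin (N + 1))) {(t l').1, (t l').2}) →
      Measure.pi (fun _ : Fin (N + 1) => (volume : Measure T3).prod (gaussMeasure w ϑ))
        {y : Config (N + 1) (Fin 3) T3 | ∀ l,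
          ε ≤ ‖(Torus.geometry (Fin 3)).sepVec (y (t l).1).1 (y (t l).2).1‖ ∧
          ‖(Torus.geometry (Fin 3)).sepVec (y (t l).1).1 (y (t l).2).1‖ ≤
            ε + δ * ‖(y (t l).1).2 - (y (t l).2).2‖} ≤ ENNReal.ofReal (C₄ * ε ^ 2 * δ) ^ k := by
    intro t ht hd
    rw [← ENNReal.ofReal_pow (by positivity)]
    exact hC₄ (N + 1) ε δ hε0 hε4 hδ hδε k t ht hd
  have hTU : ∀ (a : Fin (N + 1)) (bs : Fin k → Fin (N + 1)), Function.Injective bs → (∀ i, bs i ≠ a) →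
      Measure.pi (fun _ : Fin (N + 1) => (volume : Measure T3).prod (gaussMeasure w ϑ))
        {y : Config (N + 1) (Fin 3) T3 | ∀ i,
          ε ≤ ‖(Torus.geometry (Fin 3)).sepVec (y a).1 (y (bs i)).1‖ ∧
          ‖(Torus.geometry (Fin 3)).sepVec (y a).1 (y (bs i)).1‖ ≤ ε + δ * ‖(y a).2 - (y (bs i)).2‖} ≤
        ENNReal.ofReal (C₃ * ε ^ (2 * k) * δ ^ k) := by
    intro a bs hinj hba
    have h := hC₃ (N + 1) ε hε0 hε4 a bs hinj hba (fun _ => δ) (fun _ => hδ) (fun _ => hδε)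
    have hS : MeasurableSet {y : Config (N + 1) (Fin 3) T3 | ∀ i,
        ε ≤ ‖(Torus.geometry (Fin 3)).sepVec (y a).1 (y (bs i)).1‖ ∧
        ‖(Torus.geometry (Fin 3)).sepVec (y a).1 (y (bs i)).1‖ ≤ ε + δ * ‖(y a).2 - (y (bs i)).2‖} := by
      rw [Set.setOf_forall]
      exact MeasurableSet.iInter fun i => measurableSet_shell N ε δ a (bs i)
    have h1 : (fun y : Config (N + 1) (Fin 3) T3 =>
        ENNReal.ofReal ((1 + ‖(y a).2‖ + ∑ i, ‖(y (bs i)).2‖) ^ 0)) = fun _ => 1 := by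
      funext y
      rw [pow_zero, ENNReal.ofReal_one]
    rw [h1, lintegral_indicator_const hS, one_mul, Finset.prod_const, Finset.card_univ,
      Fintype.card_fin] at h
    exact h
  -- symmetry of the shell relation
  have hds : ∀ (i j : Fin (N + 1)) (y : Config (N + 1) (Fin 3) T3),
      ‖(Torus.geometry (Fin 3)).sepVec (y j).1 (y i).1‖ = ‖(Torus.geometry (Fin 3)).sepVec (y i).1 (y j).1‖ :=
    fun i j y => by rw [Torus.norm_geometry_sepVec, Torus.norm_geometry_sepVec, Torus.euclidDist_comm]
  -- the abstract assembly
  have key := lintegral_card_filter_pow_le G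
    (fun (q : Fin (N + 1) × Fin (N + 1)) (y : Config (N + 1) (Fin 3) T3) =>
      q.1 ≠ q.2 ∧ (ε ≤ ‖(Torus.geometry (Fin 3)).sepVec (y q.1).1 (y q.2).1‖ ∧
        ‖(Torus.geometry (Fin 3)).sepVec (y q.1).1 (y q.2).1‖ ≤ ε + δ * ‖(y q.1).2 - (y q.2).2‖))
    (fun q => (MeasurableSet.const _).inter (measurableSet_shell N ε δ q.1 q.2))
    (fun q y hy => by
      obtain ⟨h1, h2⟩ := hy
      refine ⟨fun h => h1 h.symm, ?_⟩
      simp only [Prod.fst_swap, Prod.snd_swap]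
      rw [hds q.1 q.2 y, norm_sub_rev (y q.2).2 (y q.1).2]
      exact h2)
    (fun q y hy => hy.1)
    (fun t ht => localGibbsLaw_matchingShells_le b ϑ w hb hϑ σ hσ hσ2 hlam N Φ δ k hMU t ht)
    (fun a B hB => localGibbsLaw_starShells_le b ϑ w hb hϑ σ hσ hσ2 hlam N Φ δ k hTU a B hB)
  -- the real-arithmetic clean-up
  have hNε : ((N : ℝ) + 1) * ε ^ 3 = σ ^ 3 := by
    have h := succ_mul_hsDiameter_pow_three σ N
    push_cast at h
    exact h
  have hkey : (k.factorial : ℝ) * (N.choose k : ℝ) * (C₃ * ε ^ (2 * k) * δ ^ k) ≤ C₃ := by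
    have h1 : (k.factorial : ℝ) * (N.choose k : ℝ) ≤ (N : ℝ) ^ k := by
      have h := Nat.descFactorial_le_pow N k
      rw [Nat.descFactorial_eq_factorial_mul_choose] at h
      exact_mod_cast h
    have h2 : (N : ℝ) ^ k * (ε ^ (2 * k) * δ ^ k) ≤ 1 := by
      have hσ3 : σ ^ 3 ≤ 1 := pow_le_one₀ hσ.le (by linarith)
      calc (N : ℝ) ^ k * (ε ^ (2 * k) * δ ^ k) ≤ ((N : ℝ) + 1) ^ k * (ε ^ (2 * k) * ε ^ k) :=
            mul_le_mul (pow_le_pow_left₀ (Nat.cast_nonneg N) (by linarith) k)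
              (mul_le_mul_of_nonneg_left (pow_le_pow_left₀ hδ hδε k) (by positivity))
              (by positivity) (by positivity)
        _ = (((N : ℝ) + 1) * ε ^ 3) ^ k := by
            rw [mul_pow, ← pow_mul, ← pow_add, show 2 * k + k = 3 * k by ring]
        _ = (σ ^ 3) ^ k := by rw [hNε]
        _ ≤ 1 := pow_le_one₀ (by positivity) hσ3
    calc (k.factorial : ℝ) * (N.choose k : ℝ) * (C₃ * ε ^ (2 * k) * δ ^ k)
        = C₃ * (((k.factorial : ℝ) * (N.choose k : ℝ)) * (ε ^ (2 * k) * δ ^ k)) := by ring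
      _ ≤ C₃ * ((N : ℝ) ^ k * (ε ^ (2 * k) * δ ^ k)) :=
          mul_le_mul_of_nonneg_left (mul_le_mul_of_nonneg_right h1 (by positivity)) hC₃0.le
      _ ≤ C₃ * 1 := mul_le_mul_of_nonneg_left h2 hC₃0.le
      _ = C₃ := mul_one _
  have hfirst : ((((N + 1) * (N + 1)) ^ k : ℕ) : ℝ) * (4 ^ k * (C₄ * ε ^ 2 * δ) ^ k) =
      (4 * C₄ * (((N : ℝ) + 1) ^ 2 * ε ^ 2 * δ)) ^ k := by
    push_cast
    rw [← mul_pow, ← mul_pow]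
    congr 1
    ring
  have hreal : 2 * (((((N + 1) * (N + 1)) ^ k : ℕ) : ℝ) * (4 ^ k * (C₄ * ε ^ 2 * δ) ^ k)) +
      (4 * (k : ℝ) ^ 2) ^ k * (((N + 1 : ℕ) : ℝ) * ((k : ℝ) ^ k *
        (1 + (k.factorial : ℝ) * (N.choose k : ℝ) * (2 ^ (k + 1) * (C₃ * ε ^ (2 * k) * δ ^ k))))) ≤
      2 * (4 * C₄ * (((N : ℝ) + 1) ^ 2 * ε ^ 2 * δ)) ^ k +
        ((4 * (k : ℝ) ^ 2) ^ k * ((k : ℝ) ^ k * (1 + 2 ^ (k + 1) * C₃)) + 1) * ((N : ℝ) + 1) := by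
    have hsecond : (k.factorial : ℝ) * (N.choose k : ℝ) * (2 ^ (k + 1) * (C₃ * ε ^ (2 * k) * δ ^ k)) ≤
        2 ^ (k + 1) * C₃ := by
      calc (k.factorial : ℝ) * (N.choose k : ℝ) * (2 ^ (k + 1) * (C₃ * ε ^ (2 * k) * δ ^ k))
          = 2 ^ (k + 1) * ((k.factorial : ℝ) * (N.choose k : ℝ) * (C₃ * ε ^ (2 * k) * δ ^ k)) := by ring
        _ ≤ 2 ^ (k + 1) * C₃ := mul_le_mul_of_nonneg_left hkey (by positivity)
    rw [hfirst]
    calc 2 * (4 * C₄ * (((N : ℝ) + 1) ^ 2 * ε ^ 2 * δ)) ^ k +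
          (4 * (k : ℝ) ^ 2) ^ k * (((N + 1 : ℕ) : ℝ) * ((k : ℝ) ^ k *
            (1 + (k.factorial : ℝ) * (N.choose k : ℝ) * (2 ^ (k + 1) * (C₃ * ε ^ (2 * k) * δ ^ k)))))
        ≤ 2 * (4 * C₄ * (((N : ℝ) + 1) ^ 2 * ε ^ 2 * δ)) ^ k +
          (4 * (k : ℝ) ^ 2) ^ k * (((N + 1 : ℕ) : ℝ) * ((k : ℝ) ^ k * (1 + 2 ^ (k + 1) * C₃))) := by
          have hC : 0 ≤ (4 * (k : ℝ) ^ 2) ^ k := by positivity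
          have hN1 : 0 ≤ ((N + 1 : ℕ) : ℝ) := by positivity
          have hK : 0 ≤ (k : ℝ) ^ k := by positivity
          exact add_le_add_right (mul_le_mul_of_nonneg_left (mul_le_mul_of_nonneg_left
            (mul_le_mul_of_nonneg_left (add_le_add_right hsecond 1) hK) hN1) hC) _
      _ = 2 * (4 * C₄ * (((N : ℝ) + 1) ^ 2 * ε ^ 2 * δ)) ^ k +
          (4 * (k : ℝ) ^ 2) ^ k * ((k : ℝ) ^ k * (1 + 2 ^ (k + 1) * C₃)) * ((N : ℝ) + 1) := by
          push_cast; ring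
      _ ≤ _ := add_le_add_right (mul_le_mul_of_nonneg_right (le_add_of_nonneg_right zero_le_one)
          (by positivity)) _
  -- conclusion
  calc ∫⁻ y, ENNReal.ofReal ((∑ q : Fin (N + 1) × Fin (N + 1),
          if q.1 ≠ q.2 ∧ ε ≤ ‖(Torus.geometry (Fin 3)).sepVec (y q.1).1 (y q.2).1‖ ∧
              ‖(Torus.geometry (Fin 3)).sepVec (y q.1).1 (y q.2).1‖ ≤ ε + δ * ‖(y q.1).2 - (y q.2).2‖
          then (1 : ℝ) else 0) ^ k) ∂G
      = ∫⁻ y, (((Finset.univ.filter fun q : Fin (N + 1) × Fin (N + 1) =>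
          q.1 ≠ q.2 ∧ (ε ≤ ‖(Torus.geometry (Fin 3)).sepVec (y q.1).1 (y q.2).1‖ ∧
            ‖(Torus.geometry (Fin 3)).sepVec (y q.1).1 (y q.2).1‖ ≤ ε + δ * ‖(y q.1).2 - (y q.2).2‖)).card ^ k : ℕ) :
            ℝ≥0∞) ∂G := by
        refine lintegral_congr fun y => ?_
        rw [Finset.sum_boole, ← Nat.cast_pow, ENNReal.ofReal_natCast]
    _ ≤ _ := key
    _ = ENNReal.ofReal (2 * (((((N + 1) * (N + 1)) ^ k : ℕ) : ℝ) * (4 ^ k * (C₄ * ε ^ 2 * δ) ^ k)) +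
          (4 * (k : ℝ) ^ 2) ^ k * (((N + 1 : ℕ) : ℝ) * ((k : ℝ) ^ k *
            (1 + (k.factorial : ℝ) * (N.choose k : ℝ) * (2 ^ (k + 1) * (C₃ * ε ^ (2 * k) * δ ^ k)))))) := by
        simp (disch := positivity) only [ENNReal.ofReal_add, ENNReal.ofReal_mul, ENNReal.ofReal_pow,
          ENNReal.ofReal_natCast, ENNReal.ofReal_ofNat, ENNReal.ofReal_one]
    _ ≤ _ := ENNReal.ofReal_le_ofReal hreal

/-! ## The upper tail -/

/-- `(x - r)₊ ≤ x^{j+2} / r^{j+1}` for `x ≥ 0 < r`: if `x > r` then `x - r ≤ x ≤ x (x / r)^{j+1}`.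
[folklore] -/
theorem sub_le_pow_div_pow {x r : ℝ} (hx : 0 ≤ x) (hr : 0 < r) (j : ℕ) :
    x - r ≤ x ^ (j + 2) / r ^ (j + 1) := by
  rcases le_or_gt x r with h | h
  · exact (sub_nonpos.2 h).trans (by positivity)
  · rw [le_div_iff₀ (by positivity)]
    calc (x - r) * r ^ (j + 1) ≤ x * r ^ (j + 1) :=
          mul_le_mul_of_nonneg_right (by linarith) (by positivity)
      _ ≤ x * x ^ (j + 1) := mul_le_mul_of_nonneg_left (pow_le_pow_left₀ hr.le h.le _) hx
      _ = x ^ (j + 2) := by ring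

/-- **The `N`-uniform upper tail of the static shell count under the rung-0 Gibbs law** (registered
stub `shellCount_overflow_le` of lead c10, wave 2).  There is `C₀ = C₀(w, ϑ) > 0` such that for every
`η > 0` and `s₀ > 0` there is `M₀` with
`E_G[(F_δ − C₀ μ)₊] ≤ η μ`, `μ := (N+1)² ε² δ`, whenever `0 < σ < 1/2`, `v₁ σ³ ≤ 1/2`,
`0 ≤ δ ≤ ε = hsDiameter σ N ≤ 1/4`, `s₀ (N+1) ≤ μ` and `M₀ ≤ μ` — uniformly in `N` and the flow.
Proof: with `A` from `lintegral_shellCount_pow_le` put `C₀ := 2A`; given `η` choose `j` with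
`8A/η < 2^j` and `k := j + 2`; pointwise `(F − C₀μ)₊ ≤ F^k / (C₀μ)^{k-1}` (`sub_le_pow_div_pow`), so
`E[(F − C₀μ)₊] ≤ (2 (Aμ)^k + B_k (N+1)) / (2Aμ)^{k-1} ≤ 4Aμ/2^k + B_k μ / (s₀ (2Aμ)^{k-1}) ≤ η μ`
once `2Aμ ≥ 1` and `μ ≥ B_k / (s₀ η A)`. [folklore] -/
theorem shellCount_overflow_le :
    ∀ (b ϑ : ℝ) (w : V3), 0 < b → 0 < ϑ → ∃ C₀ : ℝ, 0 < C₀ ∧ ∀ η : ℝ, 0 < η → ∀ s₀ : ℝ, 0 < s₀ → ∃ M₀ : ℝ,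
      ∀ σ : ℝ, 0 < σ → σ < 1 / 2 → v₁ * σ ^ 3 ≤ 1 / 2 →
      ∀ (N : ℕ) (Φ : HardSphereFlow (Torus.geometry (Fin 3)) (hsDiameter σ N) (N + 1)) (δ : ℝ),
        0 ≤ δ → δ ≤ hsDiameter σ N → hsDiameter σ N ≤ 1 / 4 →
        s₀ * ((N : ℝ) + 1) ≤ ((N : ℝ) + 1) ^ 2 * hsDiameter σ N ^ 2 * δ →
        M₀ ≤ ((N : ℝ) + 1) ^ 2 * hsDiameter σ N ^ 2 * δ →
        ∫⁻ y, ENNReal.ofReal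
            ((∑ q : Fin (N + 1) × Fin (N + 1),
                if q.1 ≠ q.2 ∧ hsDiameter σ N ≤ ‖(Torus.geometry (Fin 3)).sepVec (y q.1).1 (y q.2).1‖ ∧
                    ‖(Torus.geometry (Fin 3)).sepVec (y q.1).1 (y q.2).1‖ ≤ hsDiameter σ N + δ * ‖(y q.1).2 - (y q.2).2‖
                then (1 : ℝ) else 0) -
              C₀ * (((N : ℝ) + 1) ^ 2 * hsDiameter σ N ^ 2 * δ))
          ∂(localGibbsLaw σ (fun _ => b) (fun _ => w) (fun _ => ϑ) N Φ) ≤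
        ENNReal.ofReal (η * (((N : ℝ) + 1) ^ 2 * hsDiameter σ N ^ 2 * δ)) := by
  intro b ϑ w hb hϑ
  obtain ⟨A, hA, hmom⟩ := lintegral_shellCount_pow_le b ϑ w hb hϑ
  refine ⟨2 * A, by positivity, ?_⟩
  intro η hη s₀ hs₀
  obtain ⟨j, hj⟩ := pow_unbounded_of_one_lt (8 * A / η) (one_lt_two (α := ℝ))
  obtain ⟨B, hB, hmomk⟩ := hmom (j + 2)
  refine ⟨1 / (2 * A) + B / (s₀ * η * A), ?_⟩
  intro σ hσ hσ2 hlam N Φ δ hδ hδε hε4 hs hM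
  have hspec := hmomk σ hσ hσ2 hlam N Φ δ hδ hδε hε4
  set ε := hsDiameter σ N with hε
  set μ := ((N : ℝ) + 1) ^ 2 * ε ^ 2 * δ with hμ
  set G := localGibbsLaw σ (fun _ => b) (fun _ => w) (fun _ => ϑ) N Φ with hG
  -- sizes
  have hμ0 : 0 < μ := lt_of_lt_of_le (by positivity) hs
  have hAμ : 1 ≤ 2 * A * μ := by
    have h1 : 1 / (2 * A) ≤ μ := le_trans (le_add_of_nonneg_right (by positivity)) hM
    rw [div_le_iff₀ (by positivity)] at h1
    linarith
  have hBμ : B ≤ μ * (s₀ * η * A) := by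
    have h1 : B / (s₀ * η * A) ≤ μ := le_trans (le_add_of_nonneg_left (by positivity)) hM
    rwa [div_le_iff₀ (by positivity)] at h1
  set c := (2 * A * μ) ^ (j + 1) with hc
  have hc0 : 0 < c := by positivity
  -- the real inequality `(2 (Aμ)^k + B (N+1)) / c ≤ η μ`
  have hreal : (2 * (A * μ) ^ (j + 2) + B * ((N : ℝ) + 1)) / c ≤ η * μ := by
    rw [div_le_iff₀ hc0]
    have hT1 : 2 * (A * μ) ^ (j + 2) ≤ (η / 2 * μ) * c := by
      have h8 : 8 * A < 2 ^ j * η := (div_lt_iff₀ hη).1 hj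
      have h4A : 2 * A ≤ η * 2 ^ (j + 1) / 2 := by
        rw [le_div_iff₀ two_pos, pow_succ]
        nlinarith [pow_pos (two_pos (α := ℝ)) j]
      calc 2 * (A * μ) ^ (j + 2) = (2 * A) * μ * (A * μ) ^ (j + 1) := by ring
        _ ≤ (η * 2 ^ (j + 1) / 2) * μ * (A * μ) ^ (j + 1) :=
            mul_le_mul_of_nonneg_right (mul_le_mul_of_nonneg_right h4A hμ0.le) (by positivity)
        _ = (η / 2 * μ) * c := by rw [hc]; ring
    have hT2 : B * ((N : ℝ) + 1) ≤ (η / 2 * μ) * c := by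
      have hN : (N : ℝ) + 1 ≤ μ / s₀ := by
        rw [le_div_iff₀ hs₀]
        linarith
      have hc1 : 2 * A * μ ≤ c := by
        rw [hc]
        exact le_self_pow₀ hAμ (Nat.succ_ne_zero j)
      calc B * ((N : ℝ) + 1) ≤ B * (μ / s₀) := mul_le_mul_of_nonneg_left hN hB.le
        _ ≤ (μ * (s₀ * η * A)) * (μ / s₀) := mul_le_mul_of_nonneg_right hBμ (by positivity)
        _ = (η / 2 * μ) * (2 * A * μ) := by field_simp
        _ ≤ (η / 2 * μ) * c := mul_le_mul_of_nonneg_left hc1 (by positivity)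
    calc 2 * (A * μ) ^ (j + 2) + B * ((N : ℝ) + 1) ≤ (η / 2 * μ) * c + (η / 2 * μ) * c :=
          add_le_add hT1 hT2
      _ = η * μ * c := by ring
  -- pointwise: `(F - 2Aμ)₊ ≤ F^{j+2} / c`
  have hF0 : ∀ y : Config (N + 1) (Fin 3) T3, 0 ≤ ∑ q : Fin (N + 1) × Fin (N + 1),
      (if q.1 ≠ q.2 ∧ ε ≤ ‖(Torus.geometry (Fin 3)).sepVec (y q.1).1 (y q.2).1‖ ∧
          ‖(Torus.geometry (Fin 3)).sepVec (y q.1).1 (y q.2).1‖ ≤ ε + δ * ‖(y q.1).2 - (y q.2).2‖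
        then (1 : ℝ) else 0) := fun y =>
    Finset.sum_nonneg fun q _ => by split_ifs <;> norm_num
  calc ∫⁻ y, ENNReal.ofReal ((∑ q : Fin (N + 1) × Fin (N + 1),
          if q.1 ≠ q.2 ∧ ε ≤ ‖(Torus.geometry (Fin 3)).sepVec (y q.1).1 (y q.2).1‖ ∧
              ‖(Torus.geometry (Fin 3)).sepVec (y q.1).1 (y q.2).1‖ ≤ ε + δ * ‖(y q.1).2 - (y q.2).2‖
          then (1 : ℝ) else 0) - 2 * A * μ) ∂G
      ≤ ∫⁻ y, ENNReal.ofReal ((∑ q : Fin (N + 1) × Fin (N + 1),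
          if q.1 ≠ q.2 ∧ ε ≤ ‖(Torus.geometry (Fin 3)).sepVec (y q.1).1 (y q.2).1‖ ∧
              ‖(Torus.geometry (Fin 3)).sepVec (y q.1).1 (y q.2).1‖ ≤ ε + δ * ‖(y q.1).2 - (y q.2).2‖
          then (1 : ℝ) else 0) ^ (j + 2)) * (ENNReal.ofReal c)⁻¹ ∂G := by
        refine lintegral_mono fun y => ?_
        rw [← div_eq_mul_inv, ← ENNReal.ofReal_div_of_pos hc0]
        exact ENNReal.ofReal_le_ofReal (sub_le_pow_div_pow (hF0 y) (by positivity) j)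
    _ = (∫⁻ y, ENNReal.ofReal ((∑ q : Fin (N + 1) × Fin (N + 1),
          if q.1 ≠ q.2 ∧ ε ≤ ‖(Torus.geometry (Fin 3)).sepVec (y q.1).1 (y q.2).1‖ ∧
              ‖(Torus.geometry (Fin 3)).sepVec (y q.1).1 (y q.2).1‖ ≤ ε + δ * ‖(y q.1).2 - (y q.2).2‖
          then (1 : ℝ) else 0) ^ (j + 2)) ∂G) * (ENNReal.ofReal c)⁻¹ :=
        lintegral_mul_const' _ _ (ENNReal.inv_ne_top.2 (ENNReal.ofReal_pos.2 hc0).ne')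
    _ ≤ ENNReal.ofReal (2 * (A * μ) ^ (j + 2) + B * ((N : ℝ) + 1)) * (ENNReal.ofReal c)⁻¹ :=
        mul_le_mul_left hspec _
    _ = ENNReal.ofReal ((2 * (A * μ) ^ (j + 2) + B * ((N : ℝ) + 1)) / c) := by
        rw [← div_eq_mul_inv, ENNReal.ofReal_div_of_pos hc0]
    _ ≤ ENNReal.ofReal (η * μ) := ENNReal.ofReal_le_ofReal hreal

end Summit.AtomisticToContinuum.HydrodynamicLimit.Theorems.LambertianContactSwapLambertianEulerShellCountTail

end
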